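import Summits.AtomisticToContinuum.BoseEinsteinCondensation.Theses.BECCutLineWeakDisorder
import Summits.AtomisticToContinuum.BoseEinsteinCondensation.Theorems.BECRieszReverseHolderPositivityTransfer
import Summits.AtomisticToContinuum.BoseEinsteinCondensation.Theorems.BECRieszReverseHolderGroundStateEnergyFinite
import Summits.AtomisticToContinuum.BoseEinsteinCondensation.Theorems.BECRieszReverseHolderPositiveNearMinimiserExists
import Summits.AtomisticToContinuum.BoseEinsteinCondensation.Theorems.BECCutLineWeakDisorderOccupationStability
import Summits.AtomisticToContinuum.BoseEinsteinCondensation.Theorems.BECHardSphereReductionZeroModeNonVacuity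

/-!
# Crux `HardSphereBEC` (stmt-11885), line `registered`, skeleton v4 — the FORMAL kernel of stub S1:
# positivity transfer for unit hard spheres, from the shared crux `GroundStateRigidity` (stmt-9072)

Route `BECHardSphereReduction`, lead c7 (2026-08-17).  `HS₁ = ⊤·1_{[0,1]}`, `L_N(η) = (N/η)^{1/3}`,
`φ₀ = L^{-3/2}·1_{Λ_L}`.

The registered stub `stub_infraredBound` (S1) of `Cruxes/HardSphereBEC/Lines/birth.lean` is
`∀Ψ`-typed: a zero-mode bound for ALL near-minimisers.  Every positivity method (and the mesoscopic
reduction `sparsePositiveZeroMode_of_windowBound`, p160057) yields it for NONNEGATIVE near-minimisers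
only.  The passage between the two is the fixed-`N` **positivity transfer** of the summit's positivity
routes (`positivityTransfer_proof`, route `BECRieszReverseHolder`, item 12846, PROVED as an
implication): with `E₀ < ⊤` (`groundStateEnergyFinite_proof`), a nonnegative near-minimiser at every
slack (`positiveNearMinimiserExists_proof`) and `√N‖·‖₂`-Lipschitz continuity of `√occ`
(`occupationStability_proof`) — all PROVED — the one open input is phase rigidity of the near-ground
states, the shared crux `GroundStateRigidity` (stmt-AtomisticToContinuum-9072, decl of
`Theses/BECCutLineWeakDisorder.lean`; for hard cores = uniqueness of the energy-minimising component
of the finite-energy region, see `Cruxes/GroundStateRigidity/Disproof.lean`).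

* `isRepulsiveFiniteRange_unitHardSphere` — `HS₁` is an admissible interaction;
* `positivityTransferHS_of_groundStateRigidity` — **9072 ⟹ the registered stub
  `stub_positivityTransferHS` of skeleton v4** (its signature verbatim as conclusion): below a
  threshold `η₁ > 0`, for every `η ∈ (0, η₁)`, eventually in `N`, for every constant `c > 0` and slack
  `δ₁ > 0`: if every NONNEGATIVE `δ₁`-near-minimiser of the unit-hard-sphere Dirichlet energy in the box
  `L_N(η)` has `⟨φ₀,γ_Φφ₀⟩ ≥ cN`, then for some slack `δ₂ > 0` EVERY `δ₂`-near-minimiser has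
  `⟨φ₀,γ_Ψφ₀⟩ ≥ (c/4)N` (rigidity tolerance `c/4`, then `t + t ≤ √(cN) ≤ √occ Ψ + t` with `t = √N·√(c/4)`).
-/

noncomputable section

namespace Summit.AtomisticToContinuum.BoseEinsteinCondensation.Cruxes.HardSphereBEC

open MeasureTheory ENNReal Filter Topology Literature.MathematicalPhysics.QuantumManyBody.BoseGas
open Summit.AtomisticToContinuum.BoseEinsteinCondensation.Theorems

/-- The unit hard-sphere profile `⊤·1_{[0,1]}` is an admissible (measurable, finite-range)
interaction. [cite: LSSY2005, Ch. 2 (2.1)] -/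
theorem isRepulsiveFiniteRange_unitHardSphere :
    IsRepulsiveFiniteRange (Set.indicator (Set.Iic 1) (fun _ : ℝ => (⊤ : ℝ≥0∞))) :=
  ⟨measurable_hardSphere, 1, hardSphere_range_one⟩

/-- **Positivity transfer for unit hard spheres from `GroundStateRigidity` (stmt-9072).**  Below
`η₁ := min ρ₀^{fin} ρ₀^{rig}`, for `η ∈ (0, η₁)`, eventually in `N` (where `E₀(HS₁,N,L_N η) < ⊤` and
the near-ground states are phase-rigid), a zero-mode bound `cN` for the NONNEGATIVE `δ₁`-near-minimisers
transfers to the bound `(c/4)N` for ALL `δ₂`-near-minimisers, `δ₂ := min δ_rig(c/4) δ₁`: a positive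
`δ₂`-near-minimiser `Φ` exists, rigidity puts any `δ₂`-near-minimiser `Ψ` within `‖Φ - c₁Ψ‖₂² ≤ c/4`
of it up to a unit phase, and `√occ Φ ≤ √occ Ψ + √N‖Φ - c₁Ψ‖₂` (`occupationStability_proof`).
The conclusion is the registered stub `stub_positivityTransferHS` of skeleton v4, verbatim.
[cite: LSSY2005, §1.2 (1.17)–(1.19)] -/
theorem positivityTransferHS_of_groundStateRigidity
    (hrig : Summit.AtomisticToContinuum.BoseEinsteinCondensation.Theses.BECCutLineWeakDisorder.GroundStateRigidity) :
    ∃ η₁ : ℝ, 0 < η₁ ∧ ∀ η : ℝ, 0 < η → η < η₁ → ∀ᶠ N : ℕ in Filter.atTop, ∀ c : ℝ, 0 < c →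
      ∀ δ₁ : ENNReal, 0 < δ₁ →
        (∀ Φ : Literature.MathematicalPhysics.QuantumManyBody.BoseGas.TrialState N (Literature.MathematicalPhysics.QuantumManyBody.BoseGas.sideLength η N), Literature.MathematicalPhysics.QuantumManyBody.BoseGas.energy (Set.indicator (Set.Iic 1) (fun _ : ℝ => (⊤ : ENNReal))) Φ ≤ Literature.MathematicalPhysics.QuantumManyBody.BoseGas.groundStateEnergy (Set.indicator (Set.Iic 1) (fun _ : ℝ => (⊤ : ENNReal))) N (Literature.MathematicalPhysics.QuantumManyBody.BoseGas.sideLength η N) + δ₁ → (∀ X, Φ.ψ X = (‖Φ.ψ X‖ : ℂ)) → ENNReal.ofReal (c * N) ≤ Literature.MathematicalPhysics.QuantumManyBody.BoseGas.occupation N ((Literature.MathematicalPhysics.QuantumManyBody.BoseGas.box (Literature.MathematicalPhysics.QuantumManyBody.BoseGas.sideLength η N)).indicator fun _ => ((Real.sqrt (Literature.MathematicalPhysics.QuantumManyBody.BoseGas.sideLength η N ^ 3))⁻¹ : ℂ)) Φ.ψ) →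
        ∃ δ₂ : ENNReal, 0 < δ₂ ∧ ∀ Ψ : Literature.MathematicalPhysics.QuantumManyBody.BoseGas.TrialState N (Literature.MathematicalPhysics.QuantumManyBody.BoseGas.sideLength η N), Literature.MathematicalPhysics.QuantumManyBody.BoseGas.energy (Set.indicator (Set.Iic 1) (fun _ : ℝ => (⊤ : ENNReal))) Ψ ≤ Literature.MathematicalPhysics.QuantumManyBody.BoseGas.groundStateEnergy (Set.indicator (Set.Iic 1) (fun _ : ℝ => (⊤ : ENNReal))) N (Literature.MathematicalPhysics.QuantumManyBody.BoseGas.sideLength η N) + δ₂ → ENNReal.ofReal (c / 4 * N) ≤ Literature.MathematicalPhysics.QuantumManyBody.BoseGas.occupation N ((Literature.MathematicalPhysics.QuantumManyBody.BoseGas.box (Literature.MathematicalPhysics.QuantumManyBody.BoseGas.sideLength η N)).indicator fun _ => ((Real.sqrt (Literature.MathematicalPhysics.QuantumManyBody.BoseGas.sideLength η N ^ 3))⁻¹ : ℂ)) Ψ.ψ := by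
  obtain ⟨ρ₁, hρ₁, H1⟩ := groundStateEnergyFinite_proof _ isRepulsiveFiniteRange_unitHardSphere
  obtain ⟨ρ₂, hρ₂, H2⟩ := hrig _ isRepulsiveFiniteRange_unitHardSphere
  refine ⟨min ρ₁ ρ₂, lt_min hρ₁ hρ₂, fun η hη hηlt => ?_⟩
  have hη1 : η < ρ₁ := hηlt.trans_le (min_le_left _ _)
  have hη2 : η < ρ₂ := hηlt.trans_le (min_le_right _ _)
  filter_upwards [H1 η hη hη1, H2 η hη hη2, eventually_ge_atTop 1] with N hE hR hN1
  intro c hc δ₁ hδ₁ hP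
  -- `N = n + 1` (the stability fact is stated for `n + 1` particles)
  obtain ⟨n, rfl⟩ : ∃ n, N = n + 1 := ⟨N - 1, by omega⟩
  have hL : 0 < sideLength η (n + 1) := by
    unfold sideLength
    exact Real.rpow_pos_of_pos (div_pos (Nat.cast_pos.mpr n.succ_pos) hη) _
  -- rigidity tolerance `c / 4`, slack `δ₂ := min δ_rig δ₁`
  obtain ⟨δr, hδr, HR⟩ := hR (c / 4) (by positivity)
  refine ⟨min δr δ₁, lt_min hδr hδ₁, fun Ψ hΨ => ?_⟩
  -- a positive `δ₂`-near-minimiser `Φ` (exists since `E₀ ≠ ⊤`)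
  obtain ⟨Φ, hΦE, hΦpos⟩ := positiveNearMinimiserExists_proof _ (n + 1) _ hE (min δr δ₁) (lt_min hδr hδ₁)
  -- rigidity for the pair `(Φ, Ψ)`: `∫ |Φ - c₁ Ψ|² ≤ c / 4`
  obtain ⟨c₁, hc₁, hclose⟩ := HR Φ Ψ (hΦE.trans (add_le_add_right (min_le_left _ _) _))
    (hΨ.trans (add_le_add_right (min_le_left _ _) _))
  -- the nonnegative bound: `ofReal (c N) ≤ occ Φ`
  have hoccΦ := hP Φ (hΦE.trans (add_le_add_right (min_le_right _ _) _)) hΦpos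
  -- stability for the normalised measurable flat mode
  have hst := occupationStability_proof n _ _
    (_root_.AtomisticToContinuum.BECInfraredBound.aestronglyMeasurable_constMode _)
    (_root_.AtomisticToContinuum.BECInfraredBound.lintegral_constMode_sq hL) Φ Ψ c₁ hc₁
  -- `ℝ≥0∞` bookkeeping
  have h4 : ENNReal.ofReal (c * ((n + 1 : ℕ) : ℝ)) =
      4 * (ENNReal.ofReal (c / 4) * ((n + 1 : ℕ) : ℝ≥0∞)) := by
    have : c * ((n + 1 : ℕ) : ℝ) = 4 * (c / 4 * ((n + 1 : ℕ) : ℝ)) := by ring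
    rw [this, ENNReal.ofReal_mul (by norm_num : (0 : ℝ) ≤ 4),
      ENNReal.ofReal_mul (by positivity : (0 : ℝ) ≤ c / 4), ENNReal.ofReal_ofNat,
      ENNReal.ofReal_natCast]
  rw [h4] at hoccΦ
  have key := PositivityTransfer.mul_le_of_sqrt_le (ENNReal.natCast_ne_top _) ENNReal.ofReal_ne_top
    hoccΦ hst hclose
  rwa [← ENNReal.ofReal_natCast, ← ENNReal.ofReal_mul (by positivity : (0 : ℝ) ≤ c / 4)] at key

end Summit.AtomisticToContinuum.BoseEinsteinCondensation.Cruxes.HardSphereBEC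

end
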